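import Literature.AlgebraicGeometry.Resolution.GeneralizedStabilityRankOne
import Literature.AlgebraicGeometry.Resolution.GeneralizedStabilityFiniteRankLemmas
import Literature.AlgebraicGeometry.Resolution.DefectlessComposite
import HarnessLib

/-!
# Generalized stability for `K(t)`: reduction to rank one (Kuhlmann 2010, Lemma 5.4) — proofs

Topic: `Literature/AlgebraicGeometry/Resolution` (valued function fields). We PROVE Lemma 5.4
of F.-V. Kuhlmann, *Elimination of ramification I: The generalized stability theorem*, Trans.
AMS 362 (2010) 5697–5727 = arXiv:1003.5678 (p. 18), in the case the decomposition of Thm. 1.1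
needs:

> **Lemma 5.4.** To prove (R3), it suffices to prove (R4) …
> *Proof.* Let `(F,v)` satisfy the assumptions of (R3). Then `(F,v)` must also have finite rank
> … Let `v = w₁∘…∘wₙ` be the decomposition of `v` into valuations `wᵢ` of rank 1. By Lemma 2.1,
> every `Kw₁∘…∘wᵢ` is an algebraically closed field. By a repeated application of Lemma 2.8,
> `(F|K,w₁)` and all `(Fw₁∘…∘wᵢ | Kw₁∘…∘wᵢ, w_{i+1})` are valued function fields without
> transcendence defect. Hence (R4) yields that every `(Fw₁∘…∘wᵢ, w_{i+1})` is a defectless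
> field. Now a repeated application of Lemma 2.17 shows that `(F,v)` itself is a defectless
> field.

namely the named fact `Kuhlmann2010StabilityAlgClosedFiniteRank` of
`GeneralizedStabilityFiniteRank.lean` ((R3) for `F = K(t)` with `t` value-transcendental over an
algebraically closed `K`, `(F, v)` of finite rank) from the two named facts of
`GeneralizedStabilityRankOne.lean` ((R4) for rank-one rational function fields with a value-
resp. residue-transcendental generator), with Lemma 2.17 PROVED
(`IsDefectlessField.of_le_of_residue`, `DefectlessComposite.lean`) and the lemmas of
`GeneralizedStabilityFiniteRankLemmas.lean`, by induction on the rank of `K`. One induction step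
peels off the rank-one coarsening `w = w₁` of `v` on `F` (the largest proper overring
`F_w° ⊇ F°`; `F` has finite rank with `K`): if `t` is value-transcendental for `w`, then
`(F, w)` is defectless by (R4) and `Fw = Kw` (Lemma 2.5) is algebraically closed (Lemma 2.1),
hence defectless; otherwise `t₁ = t/d` is residue-transcendental for `w` (Lemma 2.8), `(F, w)`
is defectless by (R4), and `(Fw, w̄) = (Kw(t̄₁), w̄)` is again a valued rational function field
with the value-transcendental generator `t̄₁` over the algebraically closed `Kw`, whose rank is
smaller — defectless by induction; Lemma 2.17 concludes. (When `w` is trivial on `K` only the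
first case occurs; when `v` is trivial on `K`, `(F, v)` has rank one and (R4) applies
directly.)

## Content (everything PROVED)

* `Kuhlmann2010StabilityAlgClosedFiniteRank.of_rankOne` — Lemma 5.4 for `K(t)`: the named fact
  `Kuhlmann2010StabilityAlgClosedFiniteRank` from `Kuhlmann2010StabilityRankOneValueTranscendental`
  and `Kuhlmann2010StabilityRankOneResidueTranscendental`.
* `Kuhlmann2010StabilityAlgClosedValueTranscendental.of_rankOne`,
  `Kuhlmann2010StabilityValueTranscendental.of_rankOne`, `Kuhlmann2010Stability.of_rankOne` —
  assembly with Lemma 5.3 (`Kuhlmann2010StabilityAlgClosedValueTranscendental.of_parts`),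
  Lemma 5.2 (`Kuhlmann2010StabilityValueTranscendental.of_parts`) and Lemma 5.1 / Cor. 2.6 /
  Cor. 2.16 (`Kuhlmann2010Stability.of_defectlessDescent_of_algClosed`, the fundamental
  inequality being proved).

Hence the trust base of `Kuhlmann2010Stability` (and of
`Kuhlmann2010StabilityValueTranscendental`) along the printed proof is now:
`Kuhlmann2010DefectlessDescent` (Cor. 2.25), `Kuhlmann2010AlgClosedFiniteRankReduction`
(Lemma 5.3) and the two rank-one facts (R4) — exactly the results whose printed proofs pass
through henselizations (`Henselization.lean`).

## Source

* F.-V. Kuhlmann, loc. cit., §5, Lemmas 5.1–5.4, (R1)–(R4) (p. 18 of arXiv:1003.5678); §2.1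
  (Lemmas 2.1, 2.5, 2.8), §2.3 (Lemma 2.17).
-/

noncomputable section

open IsLocalRing

namespace Literature.AlgebraicGeometry.Resolution

universe u

/-! ### Lemma 5.4 for `K(t)`: induction on the rank -/

section RankOne

/-- **Kuhlmann 2010, Lemma 5.4 for `K(t)` with `t` value-transcendental over an algebraically
closed field, `(K(t), v)` of finite rank** ("(R3) ⇐ (R4)": "Let `v = w₁∘…∘wₙ` … By Lemma 2.1,
every `Kw₁∘…∘wᵢ` is an algebraically closed field. By a repeated application of Lemma 2.8,
`(F|K,w₁)` and all `(Fw₁∘…∘wᵢ | Kw₁∘…∘wᵢ, w_{i+1})` are valued function fields without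
transcendence defect. Hence (R4) yields that every `(Fw₁∘…∘wᵢ, w_{i+1})` is a defectless field.
Now a repeated application of Lemma 2.17 shows that `(F,v)` itself is a defectless field."):
the named fact `Kuhlmann2010StabilityAlgClosedFiniteRank` ((R3) for `K(t)`) follows from (R4)
for rational function fields of rank one with a value- resp. residue-transcendental generator.
PROVED by induction on the rank of `K` (the number of overrings of `K° = F° ∩ K`, finite with
that of `F°`): if `v` is trivial on `K`, `(F, v)` has rank one (`rankOne_of_comap_eq_top`) and
(R4) applies; otherwise let `w = w₁` be the rank-one coarsening of `v` on `F`
(`exists_max_proper_overring`; `F` has finite rank, `finite_overrings_of_valueTranscendental`).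
If `t` is value-transcendental for `w` (always so when `w` is trivial on `K`), then `(F, w)` is
defectless by (R4) and `Fw = Kw` (Lemma 2.5, `residueSubfield_eq_top_of_valueTranscendental`)
is algebraically closed (Lemma 2.1), hence `(Fw, w̄)` is defectless
(`isDefectlessField_of_isAlgClosed`); otherwise (Lemma 2.8,
`valueTranscendental_or_residueTranscendental`) `t₁ = t/d` has `w`-value `0` and `w`-residue
`t̄₁` transcendental over `Kw`, `(F, w)` is defectless by (R4), and `(Fw, w̄) = (Kw(t̄₁), w̄)`
(`closure_residueSubfield_union_eq_top`) is a valued rational function field with the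
value-transcendental generator `t̄₁` (`valueTranscendental_residue`) over the algebraically
closed `Kw` (`isAlgClosed_residueField_of_isAlgClosed`), whose rank is smaller
(`card_overrings_residue_lt`, `comap_residueFieldHom_residueValuationSubring`) — defectless by
induction. In both cases Lemma 2.17 (`IsDefectlessField.of_le_of_residue`) gives that `(F, v)`
is defectless. [cite: Kuhlmann2010, Section 5, Lemma 5.4] -/
theorem Kuhlmann2010StabilityAlgClosedFiniteRank.of_rankOne
    (h4v : Kuhlmann2010StabilityRankOneValueTranscendental.{u})
    (h4r : Kuhlmann2010StabilityRankOneResidueTranscendental.{u}) :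
    Kuhlmann2010StabilityAlgClosedFiniteRank.{u} := by
  -- strong induction on the number of overrings of `K°` (the rank of `K` plus one)
  suffices H : ∀ (N : ℕ) (K F : Type u) [Field K] [Field F] [Algebra K F] [IsAlgClosed K]
      (O : ValuationSubring F) (t : F),
      Finite {S : ValuationSubring K // O.comap (algebraMap K F) ≤ S} →
      Nat.card {S : ValuationSubring K // O.comap (algebraMap K F) ≤ S} = N →
      (∀ n : ℕ, 0 < n → ∀ c : K, O.valuation t ^ n ≠ O.valuation (algebraMap K F c)) →
      IntermediateField.adjoin K ({t} : Set F) = ⊤ → IsDefectlessField F O by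
    intro K F _ _ _ _ O t hvt hgen hfin
    haveI := hfin
    exact H _ K F O t inferInstance rfl hvt hgen
  intro N
  induction N using Nat.strong_induction_on with
  | _ N ih =>
  intro K F _ _ _ _ O t hfin hN hvt hgen
  haveI := hfin
  classical
  have ht0 : t ≠ 0 := ne_zero_of_valueTranscendental O hvt
  -- `K` trivially valued: `(F, O)` has rank one and (R4) applies directly
  by_cases hKtop : O.comap (algebraMap K F) = ⊤
  · obtain ⟨hO, hrk⟩ := rankOne_of_comap_eq_top O hvt hgen hKtop
    exact h4v K F O t hO hrk hvt hgen
  -- the rank-one coarsening `w` of `v` (`F` has finite rank with `K`)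
  haveI : Finite {S : ValuationSubring F // O ≤ S} :=
    finite_overrings_of_valueTranscendental O hvt hgen
  obtain ⟨O₁, hle, hO₁, hrk₁⟩ :=
    exists_max_proper_overring O (ne_top_of_valueTranscendental O hvt)
  -- case (α): `t` value-transcendental for `w`; then `Fw = Kw` is algebraically closed
  have hα : (∀ n : ℕ, 0 < n → ∀ c : K, O₁.valuation t ^ n ≠ O₁.valuation (algebraMap K F c)) →
      IsDefectlessField F O := fun hvt₁ => by
    refine IsDefectlessField.of_le_of_residue O O₁ hle (h4v K F O₁ t hO₁ hrk₁ hvt₁ hgen) ?_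
    haveI : IsAlgClosed (ResidueField O₁) :=
      isAlgClosed_residueField_of_residueSubfield_eq_top (K := K) O₁
        (residueSubfield_eq_top_of_valueTranscendental O₁ hvt₁ hgen)
    exact isDefectlessField_of_isAlgClosed _ _
  by_cases hPtop : O₁.comap (algebraMap K F) = ⊤
  · -- `w` is trivial on `K`: then `w(t) ≠ 0`, i.e. case (α)
    apply hα
    have hKO₁ : ∀ c : K, algebraMap K F c ∈ O₁ := fun c => by
      change c ∈ O₁.comap (algebraMap K F)
      rw [hPtop]
      exact ValuationSubring.mem_top c
    have hKw : ∀ c : K, c ≠ 0 → O₁.valuation (algebraMap K F c) = 1 := fun c hc => by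
      have h1 := (O₁.valuation_le_one_iff _).mpr (hKO₁ c)
      have h2 := (O₁.valuation_le_one_iff _).mpr (hKO₁ c⁻¹)
      rw [map_inv₀, map_inv₀] at h2
      exact le_antisymm h1 ((inv_le_one₀ (zero_lt_iff.mpr ((map_ne_zero _).mpr
        ((map_ne_zero (algebraMap K F)).mpr hc)))).mp h2)
    intro n hn c h
    -- `w(t)ⁿ = w(c) = 1` forces `t, t⁻¹ ∈ F_w°`, and then `F_w° = F`
    have hc0 : c ≠ 0 := by
      rintro rfl
      rw [map_zero, map_zero, pow_eq_zero_iff hn.ne', map_eq_zero] at h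
      exact ht0 h
    rw [hKw c hc0] at h
    have h' : O₁.valuation t = 1 := by
      have := valuation_eq_of_pow_eq O₁ (a := t) (b := 1) hn.ne' (by rw [map_one, one_pow]; exact h)
      rwa [map_one] at this
    have htO₁ : t ∈ O₁ := (O₁.valuation_le_one_iff _).mp h'.le
    have htiO₁ : t⁻¹ ∈ O₁ := (O₁.valuation_le_one_iff _).mp (by rw [map_inv₀, h', inv_one])
    apply hO₁
    refine eq_top_iff.mpr fun y _ => ?_
    by_cases hy0 : y = 0
    · rw [hy0]
      exact zero_mem _
    obtain ⟨k, c', hyv⟩ := exists_valuation_eq_of_valueTranscendental O hvt hgen hy0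
    rw [← map_zpow₀, ← map_mul] at hyv
    exact mem_of_valuation_le_of_mem O O₁ hle hyv.le
      (mul_mem (hKO₁ c') (zpow_mem_of_mem_of_inv_mem O₁ htO₁ htiO₁ k))
  -- `w` non-trivial on `K`: dichotomy (Lemma 2.8)
  rcases valueTranscendental_or_residueTranscendental O O₁ hle hvt with hvt₁ | ⟨d, hd0, ht₁, hw, htr⟩
  · exact hα hvt₁
  -- case (β): `t₁ = t/d` residue-transcendental for `w`
  have hgen₁ := adjoin_div_eq_top (K := K) (F := F) hgen hd0
  have hvt₁' := valueTranscendental_div O hvt hd0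
  refine IsDefectlessField.of_le_of_residue O O₁ hle (h4r K F O₁ ⟨_, ht₁⟩ hO₁ hrk₁ htr hgen₁) ?_
  -- `(Fw, w̄) = (Kw(t̄₁), w̄)` over the algebraically closed `Kw` of smaller rank: induction
  set P := O₁.comap (algebraMap K F) with hP
  letI : Algebra (ResidueField P) (ResidueField O₁) := (residueFieldHom K O₁).toAlgebra
  haveI : IsAlgClosed (ResidueField P) := isAlgClosed_residueField_of_isAlgClosed P
  have hcomap : (residueValuationSubring O O₁ hle).comap
      (algebraMap (ResidueField P) (ResidueField O₁)) =
      residueValuationSubring (O.comap (algebraMap K F)) P (fun _ hc => hle hc) :=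
    comap_residueFieldHom_residueValuationSubring O O₁ hle
  have hfin' : Finite {S : ValuationSubring (ResidueField P) //
      (residueValuationSubring O O₁ hle).comap
        (algebraMap (ResidueField P) (ResidueField O₁)) ≤ S} := by
    rw [hcomap]
    infer_instance
  have hlt : Nat.card {S : ValuationSubring (ResidueField P) //
      (residueValuationSubring O O₁ hle).comap
        (algebraMap (ResidueField P) (ResidueField O₁)) ≤ S} < N := by
    rw [hcomap, ← hN]
    exact card_overrings_residue_lt _ P _ hPtop
  have hvt' := valueTranscendental_residue O O₁ hle ht₁ hw hvt₁'
  have hgen' : IntermediateField.adjoin (ResidueField P)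
      ({residue O₁ ⟨_, ht₁⟩} : Set (ResidueField O₁)) = ⊤ := by
    refine eq_top_iff.mpr fun r _ => ?_
    rw [← IntermediateField.mem_toSubfield, IntermediateField.adjoin_toSubfield]
    have hrange : Set.range (algebraMap (ResidueField P) (ResidueField O₁)) =
        (residueSubfield K O₁ : Set (ResidueField O₁)) := by
      change Set.range (residueFieldHom K O₁) = _
      rw [← RingHom.coe_fieldRange, fieldRange_residueFieldHom]
    rw [hrange, closure_residueSubfield_union_eq_top O₁ ht₁ htr hgen₁]
    trivial
  exact ih _ hlt (ResidueField P) (ResidueField O₁) (residueValuationSubring O O₁ hle)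
    (residue O₁ ⟨_, ht₁⟩) hfin' rfl hvt' hgen'

end RankOne

/-! ### Assembly -/

/-- **(R2) for `K(t)` (`t` value-transcendental, `K` algebraically closed) from Lemma 5.3 and
(R4)**: `Kuhlmann2010StabilityAlgClosedValueTranscendental.of_parts` (Lemma 5.3) applied to the
proved (R3) (`Kuhlmann2010StabilityAlgClosedFiniteRank.of_rankOne`, Lemma 5.4). PROVED.
[cite: Kuhlmann2010, Section 5, Lemmas 5.3–5.4] -/
theorem Kuhlmann2010StabilityAlgClosedValueTranscendental.of_rankOne
    (hA : Kuhlmann2010AlgClosedFiniteRankReduction.{u})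
    (h4v : Kuhlmann2010StabilityRankOneValueTranscendental.{u})
    (h4r : Kuhlmann2010StabilityRankOneResidueTranscendental.{u}) :
    Kuhlmann2010StabilityAlgClosedValueTranscendental.{u} :=
  Kuhlmann2010StabilityAlgClosedValueTranscendental.of_parts hA
    (Kuhlmann2010StabilityAlgClosedFiniteRank.of_rankOne h4v h4r)

/-- **Kuhlmann 2010, Thm. 1.1 for `K(t)` with `t` value-transcendental over a defectless `K`**
from Cor. 2.25 (`Kuhlmann2010DefectlessDescent`), the proof of Lemma 5.3
(`Kuhlmann2010AlgClosedFiniteRankReduction`) and (R4) for rational function fields of rank one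
(`Kuhlmann2010StabilityRankOneValueTranscendental`,
`Kuhlmann2010StabilityRankOneResidueTranscendental`): Lemma 5.2
(`Kuhlmann2010StabilityValueTranscendental.of_parts`) composed with Lemmas 5.3–5.4. PROVED; this
is the current trust base of the named fact `Kuhlmann2010StabilityValueTranscendental`
(`GeneralizedStabilityRational.lean`). [cite: Kuhlmann2010, Section 5, Lemmas 5.2–5.4] -/
theorem Kuhlmann2010StabilityValueTranscendental.of_rankOne
    (hD : Kuhlmann2010DefectlessDescent.{u})
    (hA : Kuhlmann2010AlgClosedFiniteRankReduction.{u})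
    (h4v : Kuhlmann2010StabilityRankOneValueTranscendental.{u})
    (h4r : Kuhlmann2010StabilityRankOneResidueTranscendental.{u}) :
    Kuhlmann2010StabilityValueTranscendental.{u} :=
  Kuhlmann2010StabilityValueTranscendental.of_parts hD
    (Kuhlmann2010StabilityAlgClosedValueTranscendental.of_rankOne hA h4v h4r)

/-- **Kuhlmann 2010, Thm. 1.1 over a trivially valued ground field** from Cor. 2.25, the proof
of Lemma 5.3 and (R4) in rank one: the fundamental inequality (PROVED), Cor. 2.6, Cor. 2.16,
Lemmas 5.1–5.4 (`Kuhlmann2010Stability.of_defectlessDescent_of_algClosed` composed with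
`Kuhlmann2010StabilityAlgClosedValueTranscendental.of_rankOne`). PROVED; the trust base of
`Kuhlmann2010Stability` along the printed proof is now `Kuhlmann2010DefectlessDescent`
(Cor. 2.25), `Kuhlmann2010AlgClosedFiniteRankReduction` (Lemma 5.3) and the two rank-one facts
(R4) — the three results whose printed proofs use henselizations.
[cite: Kuhlmann2010, Thm. 1.1 and Section 5, Lemmas 5.1–5.4] -/
theorem Kuhlmann2010Stability.of_rankOne (hD : Kuhlmann2010DefectlessDescent.{u})
    (hA : Kuhlmann2010AlgClosedFiniteRankReduction.{u})
    (h4v : Kuhlmann2010StabilityRankOneValueTranscendental.{u})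
    (h4r : Kuhlmann2010StabilityRankOneResidueTranscendental.{u}) : Kuhlmann2010Stability.{u} :=
  Kuhlmann2010Stability.of_defectlessDescent_of_algClosed hD
    (Kuhlmann2010StabilityAlgClosedValueTranscendental.of_rankOne hA h4v h4r)

end Literature.AlgebraicGeometry.Resolution
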